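/- Copyright: the b2b-balaban cell (near-miss cell 7), T⁴-continuum fan-out; row NE7b ROUND-2 swarm, seat
t4-ne7b-formalise-leaf-03 (gen 4) (road W-RP, row W6 «W-ROAD APEX ∕ HEADLINE» of `t4/b2b-balaban-t4-ne7b-p1/LEAVES-NE7b.md`
v3.50, owner's NEW ROW journal l.16605, CLAIM l.16612; file 3 of 3).  Released under the licence of the surrounding project. -/
import Summits.QuantumFields.BalabanUV.T4Continuum.Support.HistoryChessboardApex

/-!
# Road W-RP, row W6 file 3: THE HEADLINE FROM THE W ROAD — the four T⁴ targets and `ContinuumYM4Torus D`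

Summits-side support leaf of the T⁴-continuum cell (rung (B)+1 on a FINITE torus only; NOT infinite volume, NOT the
mass gap, NOT the Clay statement; NOT a proof of the spine estimate NE7b).  Row NE7b, road **W-RP** (R-OWNER-23-2 ∕
R-OWNER-23-8), row **W6**, file 3 — the mirror of the count road's headline files (`HistoryRealiseCellsRunHeadline` p219461 ∕
v1.1 p219850, `…HeadlineT3b` p223402, `…HeadlineT3bP` p224237) for road W, over file 2's apex theorem
`HistoryChessboardApex.hybridNE7Under_of_chessboardRoad_fsc`.  [folklore] composition BY NAME with the apex lineage
(`T4ApexHybrid.limit_exists_of_hybridNE7Under`, `limit_unique_of_hybridNE7Under`, `targets_of_hybridNE7Under`,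
`T4ContinuumYM4Torus.continuumYM4Torus_of_targets`); no `def`, no `structure`, no `[cite:]` tag, nothing printed asserted, no
`Prop` fact minted (c1), no constant (c2∕c6), no exit ∕ socket ∕ `HistoryConstants` file touched (c3).

WHAT.  Under ONE displayed hypothesis UNDER THE PREFIX `T4ContinuumYM4Torus.ForSmallCouplings` — «for all SMALL-coupling tuned
runs `g₀` and all loop strings `os`, a `ChessboardRoadWitness`» (file 2) —: **`limit_exists_of_chessboardRoad_fsc`** ∕
**`limit_unique_of_chessboardRoad_fsc`** (data with measurable averaging maps), **`targets_of_chessboardRoad_fsc`** (the four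
T⁴ targets for (0.4)-block-averaged data on `SU(N)` with a measurable small-loop average) — ALL THREE WITHOUT `(B)` OR
`BetaPertHyp` AS INPUTS (the targets are themselves prefixed by the two pins, and the W road's apex input is pin-free:
file 1 `HistoryChessboardPinned`, file 2 `forSmallCouplings_stringwise_of_chessboardRoad`) — and **THE HEADLINE PREDICATE
`continuumYM4Torus_of_chessboardRoad_fsc (hBA) (hE) (hB : B16.EndStatementBPrinted D.C) (hβ : BetaPertHyp D.βfun) (hData) :
T4ContinuumYM4Torus.ContinuumYM4Torus D`**, where the two pins enter BY NAME, at `continuumYM4Torus_of_targets` and nowhere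
else.  The every-`γ, g > 0` forms (`…_of_chessboardRoad`) are corollaries (thresholds `1, 1`).

HONEST READING (verbatim for headlines; c4, R-OWNER-23-8 wording).  «Row NE7b, road W-RP (the printed, centred 4-d averaging
prescription [B12] (0.3)–(0.4)): kernel-complete BY NAME from the displayed readings to `ContinuumYM4Torus D`:
`ContinuumYM4Torus D ⇐ (B) ∧ BetaPertHyp ∧ [∀ small-coupling tuned run ∀ string: a ChessboardRoadWitness]`, and the witness
DISPLAYS — as hypothesis shapes, none in print, none a theorem of the tree — per run and cutoff the 21 clauses of the
per-cutoff event reading `CutoffReading` ((EXT)+(DRESS) `repr`∕`ev_cover`∕`bad_disj`, (EXT)∘(LOC) `bad_sub`, the RP-package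
(RP-ext) = the covariance reading (γ) of the printed average — produced BY NAME for the Gibbs towers by rows W3f–W3m ∕ W4c
modulo the typing identification «`avgFun ℰ` = (0.4)» and the identification of the run's state with the tower law —,
(LOC), (R-sym), (U1)+(G2) with (B)'s lower half INSIDE `univ_le` as a reading), the E1∕E2 representation identities, NE7c's
`ShellWeightBound`, NE7's `ReindexedBudget` (carrying node U4′'s sizes and the recent-scale rates, hence the content of
NE1′–NE5, NE9) and four summable rates; the W-road END consumes neither pin nor the coupling window (thresholds `1, 1`).
Against the count road's headline (p224237): NO H3 (no pedigrees, no price sentence (E2)∕(R1), no numerator readings), NO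
constants-side prefix; instead the chessboard∕event readings.  NOTHING of the nine discharged; spine count 0∕9 UNCHANGED;
NE7b NOT proved; finite T⁴ only.»  HONEST DEPENDENCY (cell): continuum YM on T⁴ ⇐ BetaPertH ∧ nine spine estimates (0/9
proved); BetaPertH ⇐ (D1) ∧ (D4) ∧ CAP+tail; G-an2-4 gates asym, D1 and NE2/3/4.  This file changes none of it. -/

open Literature.MathematicalPhysics.QuantumFieldTheory.Balaban1983to89
open T4Continuum
open Summit.QuantumFields.BalabanUV.T4Continuum.HistoryChessboardApex

namespace Summit.QuantumFields.BalabanUV.T4Continuum.HistoryChessboardHeadline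

noncomputable section

section Under

variable {F : T4Family} {G : Type*} [GaugeGroup G] [MeasurableSpace G] [HaarData G] [RegularGaugeGroup G]

/-- **COROLLARY: EXISTENCE** of the continuum limit of every joint expectation of unit-scale averaged loop variables along
the full sequence of spacings, under the prefix (`D.ym4_torus_continuum_limit_exists`), for data with measurable averaging
maps, GIVEN the prefixed chessboard-road witnesses — by `T4ApexHybrid.limit_exists_of_hybridNE7Under` over file 2's
`hybridNE7Under_of_chessboardRoad_fsc`.  No pin is an input (the target carries its own prefix).  CONDITIONAL; NE7b NOT proved.
[folklore] -/
theorem limit_exists_of_chessboardRoad_fsc (D : FiniteEpsData F G) (hM : D.AvgMeasurable)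
    (hData : T4ContinuumYM4Torus.ForSmallCouplings D fun g₀ => ∀ os : List (ULoop F),
      ∃ (ι Λ : Type) (_ : DecidableEq ι) (Ω Ω' : ℕ → Type) (_ : ∀ K, MeasurableSpace (Ω K))
        (_ : ∀ K, MeasurableSpace (Ω' K)) (d N : ℕ) (_ : NeZero N),
        Nonempty (ChessboardRoadWitness D g₀ os ι Λ Ω Ω' d N)) :
    D.ym4_torus_continuum_limit_exists :=
  T4ApexHybrid.limit_exists_of_hybridNE7Under D hM (hybridNE7Under_of_chessboardRoad_fsc D hData)

/-- **COROLLARY: UNIQUENESS** of the limit points (`D.ym4_torus_continuum_limit_unique`) under the same displayed data — by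
`T4ApexHybrid.limit_unique_of_hybridNE7Under`.  CONDITIONAL; NE7b NOT proved. [folklore] -/
theorem limit_unique_of_chessboardRoad_fsc (D : FiniteEpsData F G) (hM : D.AvgMeasurable)
    (hData : T4ContinuumYM4Torus.ForSmallCouplings D fun g₀ => ∀ os : List (ULoop F),
      ∃ (ι Λ : Type) (_ : DecidableEq ι) (Ω Ω' : ℕ → Type) (_ : ∀ K, MeasurableSpace (Ω K))
        (_ : ∀ K, MeasurableSpace (Ω' K)) (d N : ℕ) (_ : NeZero N),
        Nonempty (ChessboardRoadWitness D g₀ os ι Λ Ω Ω' d N)) :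
    D.ym4_torus_continuum_limit_unique :=
  T4ApexHybrid.limit_unique_of_hybridNE7Under D hM (hybridNE7Under_of_chessboardRoad_fsc D hData)

end Under

section SU

variable {F : T4Family} {N : ℕ} [NeZero N] {ℰ : LoopAverage (Matrix.specialUnitaryGroup (Fin N) ℂ)}

/-- **THE FOUR T⁴ TARGETS FROM THE W ROAD**, for (0.4)-block-averaged data on `SU(N)` with a measurable small-loop average:
`hybridNE7Under_of_chessboardRoad_fsc` ∘ `T4ApexHybrid.targets_of_hybridNE7Under`.  NO PIN IS AN INPUT: each target is itself
prefixed by `(B)` and `BetaPertHyp`, and the W road's apex input is pin-free.  CONDITIONAL on the displayed prefixed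
witnesses; NE7b NOT proved. [folklore] -/
theorem targets_of_chessboardRoad_fsc (D : FiniteEpsData F (Matrix.specialUnitaryGroup (Fin N) ℂ))
    (hBA : D.IsBlockAveraged ℰ) (hE : ℰ.MeasurableE)
    (hData : T4ContinuumYM4Torus.ForSmallCouplings D fun g₀ => ∀ os : List (ULoop F),
      ∃ (ι Λ : Type) (_ : DecidableEq ι) (Ω Ω' : ℕ → Type) (_ : ∀ K, MeasurableSpace (Ω K))
        (_ : ∀ K, MeasurableSpace (Ω' K)) (d M : ℕ) (_ : NeZero M),
        Nonempty (ChessboardRoadWitness D g₀ os ι Λ Ω Ω' d M)) :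
    D.ym4_torus_continuum_limit_exists ∧ D.ym4_torus_continuum_limit_unique ∧
      D.limit_reflectionPositive ∧ D.limit_torusCovariant :=
  T4ApexHybrid.targets_of_hybridNE7Under hBA hE (hybridNE7Under_of_chessboardRoad_fsc D hData)

/-- **THE HEADLINE PREDICATE FROM THE W ROAD**: `T4ContinuumYM4Torus.ContinuumYM4Torus D` for (0.4)-block-averaged data on
`SU(N)` with a measurable small-loop average, GIVEN the two pins `(B) = B16.EndStatementBPrinted D.C` and `BetaPertHyp D.βfun`
BY NAME — consumed HERE ONLY, by `T4ContinuumYM4Torus.continuumYM4Torus_of_targets` — and a `ChessboardRoadWitness` for all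
small-coupling tuned runs and every loop string.  Honest reading in the module docstring: the located new estimates (the
per-cutoff event readings of road W-RP, NE7c, NE7) are INSIDE the witness; nothing of them is discharged; NE7b NOT proved;
count 0∕9. [folklore] -/
theorem continuumYM4Torus_of_chessboardRoad_fsc (D : FiniteEpsData F (Matrix.specialUnitaryGroup (Fin N) ℂ))
    (hBA : D.IsBlockAveraged ℰ) (hE : ℰ.MeasurableE)
    (hB : B16.EndStatementBPrinted D.C) (hβ : BetaPertHyp D.βfun)
    (hData : T4ContinuumYM4Torus.ForSmallCouplings D fun g₀ => ∀ os : List (ULoop F),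
      ∃ (ι Λ : Type) (_ : DecidableEq ι) (Ω Ω' : ℕ → Type) (_ : ∀ K, MeasurableSpace (Ω K))
        (_ : ∀ K, MeasurableSpace (Ω' K)) (d M : ℕ) (_ : NeZero M),
        Nonempty (ChessboardRoadWitness D g₀ os ι Λ Ω Ω' d M)) :
    T4ContinuumYM4Torus.ContinuumYM4Torus D :=
  T4ContinuumYM4Torus.continuumYM4Torus_of_targets hB hβ (targets_of_chessboardRoad_fsc D hBA hE hData)

/-- **The every-`γ, g > 0` headline** (a witness for EVERY positive-coupling tuned run and every string; thresholds `1, 1` via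
file 2's `hybridNE7Under_of_chessboardRoad`).  CONDITIONAL; NE7b NOT proved. [folklore] -/
theorem continuumYM4Torus_of_chessboardRoad (D : FiniteEpsData F (Matrix.specialUnitaryGroup (Fin N) ℂ))
    (hBA : D.IsBlockAveraged ℰ) (hE : ℰ.MeasurableE)
    (hB : B16.EndStatementBPrinted D.C) (hβ : BetaPertHyp D.βfun)
    (hData : ∀ (γ g : ℝ) (g₀ : ℕ → ℝ), 0 < γ → 0 < g → D.Tuned γ g g₀ → ∀ os : List (ULoop F),
      ∃ (ι Λ : Type) (_ : DecidableEq ι) (Ω Ω' : ℕ → Type) (_ : ∀ K, MeasurableSpace (Ω K))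
        (_ : ∀ K, MeasurableSpace (Ω' K)) (d M : ℕ) (_ : NeZero M),
        Nonempty (ChessboardRoadWitness D g₀ os ι Λ Ω Ω' d M)) :
    T4ContinuumYM4Torus.ContinuumYM4Torus D :=
  T4ContinuumYM4Torus.continuumYM4Torus_of_targets hB hβ
    (T4ApexHybrid.targets_of_hybridNE7Under hBA hE (hybridNE7Under_of_chessboardRoad D hData))

end SU

end

end Summit.QuantumFields.BalabanUV.T4Continuum.HistoryChessboardHeadline
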